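import Summits.CriticalPhenomena.PercolationContinuityZ3.Theorems.Transplant.FKConnectivityAllQPat3SPGoodCDefs
import Summits.CriticalPhenomena.PercolationContinuityZ3.Theorems.Transplant.FKConnectivityAllQTsymSP
import Summits.CriticalPhenomena.PercolationContinuityZ3.Theorems.Transplant.FKConnectivityAllQAntipodalDictionary
import Summits.CriticalPhenomena.PercolationContinuityZ3.Theorems.Transplant.FKConnectivityAllQDeltaSupport
import HarnessLib

/-!
# Connectivity correlation inequalities for `φ_{w,q}`, every `q > 0` — SP-goodness of a minor controls Conjecture T's functional; CONJECTURE SP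

Proof file with definitions (`--supports stmt-CriticalPhenomena-4575`), census lineage (gen 37) of LANE 2's FK sub-programme; builds on
p205010 (kernel theorem, internal audit signed; external expert review pending).  No named facts, no sorries.

Generic (graph-independent) facts linking census g37's `FK.SPGoodC E C b s t` (levelwise `T_sym ≥ 0` and the three `STAR ≥ 0` on the
minor `(E, C)`) to census gen 25's Conjecture T functional: the weight forms `FK.mval2C_eq_sum_lev2C`, `FK.mval2C_nonneg_of_lev2C`,
`FK.mval2C_tsym2Tab`, `FK.tvalC_mono`; the dictionary row `FK.antipodalT_eq_tvalC` (`antipodalT q z s t F C = tvalC (q^·) F C z s t T(apex)`);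
`FK.antipodalT_nonneg_of_spGoodC` (SP-good minor ⇒ `T_q(b,s,t;F,C) ≥ 0`, via `T(apex) ≥ T_sym`); `FK.antipodalT_eq_zero_of_not_distinct`
(coincident marks); the LOCAL FORM through `…DeltaSupport.lean`: SP-goodness of the minors of the support of `w` gives `δ_w ≥ 0`, the
hub inequality and the sharper correlation at every triple (`FK.deltaMass_nonneg_of_spGood_support`, `FK.hubUnder_of_spGood_support`,
`FK.real_conn_union_le_of_spGood_support`) — instantiated by THEOREM SP in `…Pat3DeltaSP.lean`.  **CONJECTURE SP** (`FK.SPGoodPos`, conjecture-shaped, NOT asserted): every minor of every finite graph is SP-good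
at every three distinct marks — a THEOREM on two-terminal series–parallel networks (`FK.spGoodC_of_isTTSP`, `…Pat3TheoremSPMinor.lean`)
and census-verified far beyond (exhaustive on all graphs with ≤ 6 vertices and all their minors, on all graphs with ≤ 7 vertices,
on K6, K7, K_{4,4}, K_{3,5}, Petersen, Q3, W6, W7, sub(K5), V8 with random contracted sets: ≈ 1.2 × 10¹⁰ level evaluations,
0 negatives; kit j226017, j226060, j226107, j226360).  It is the induction-friendly (symmetric, STAR-carrying) strengthening of
Conjecture T: `FK.antipodalTPos_of_spGoodPos : SPGoodPos → AntipodalTPos`, hence `FK.hubFKPos_of_spGoodPos : SPGoodPos → HubFKPos`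
(ALR (13)/(14) for every `q > 0`).  Census caveat recorded with it: the 𝒯₂ generator `c1Tab` is NOT nonnegative off the
series–parallel class (K_{2,3} read between two vertices of its 3-side, kit j226086), so the gluing leaves of THEOREM SP do not carry
over verbatim; SP itself showed no exception.
[cite: AyyerLinussonRavichandran2025, §7 eq. (13)–(15), Conj. 7.1 (p. 22)] [cite: Grimmett2006, §3.8 (pp. 61–62); §3.9 (p. 63)]
-/

namespace Summit.CriticalPhenomena.PercolationContinuityZ3.Theorems

namespace FK

open SimpleGraph Literature.Probability.LatticeModels Literature.Probability.Percolation
open Literature.Probability.Percolation.DecisionTree (ind ind_of_mem ind_of_not_mem)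
open scoped Classical

variable {V : Type*} [Fintype V]

/-! ### Weight forms on minors -/

section WeightsC

omit [Fintype V]

/-- The weighted two-level value on a minor expands over levels. [folklore] -/
theorem mval2C_eq_sum_lev2C (w : ℕ → ℝ) (E C : Finset (Sym2 V)) (x y s : V) (F : ℕ → Pat3 → Pat3 → ℤ) (M : ℕ)
    (hM : ∀ γ ∈ E.powerset, apExpC E C γ + 2 ≤ M) :
    mval2C w E C x y s F = ∑ μ ∈ Finset.range M, w μ * (lev2C E C x y s F μ : ℝ) := by
  unfold mval2C lev2C
  push_cast
  simp only [Finset.mul_sum]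
  rw [Finset.sum_comm]
  refine Finset.sum_congr rfl fun γ hγ => ?_
  have h := hM γ hγ
  have e0 : ∀ μ : ℕ, w μ * ((if apExpC E C γ = μ then (F 0 (pat3 (γ ∪ C) x y s) (pat3 (E \ γ ∪ C) x y s) : ℝ) else 0) +
      (if apExpC E C γ + 1 = μ then (F 1 (pat3 (γ ∪ C) x y s) (pat3 (E \ γ ∪ C) x y s) : ℝ) else 0)) =
      (if apExpC E C γ = μ then w (apExpC E C γ) * (F 0 (pat3 (γ ∪ C) x y s) (pat3 (E \ γ ∪ C) x y s) : ℝ) else 0) +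
      (if apExpC E C γ + 1 = μ then w (apExpC E C γ + 1) * (F 1 (pat3 (γ ∪ C) x y s) (pat3 (E \ γ ∪ C) x y s) : ℝ)
        else 0) := by
    intro μ
    by_cases a : apExpC E C γ = μ <;> by_cases b : apExpC E C γ + 1 = μ
    · exfalso; omega
    · subst a; simp
    · subst b; simp
    · simp [a, b]
  simp only [e0, Finset.sum_add_distrib, Finset.sum_ite_eq, Finset.mem_range]
  rw [if_pos (by omega), if_pos (by omega)]

/-- **Levelwise nonnegativity on a minor gives nonnegativity for every nonnegative level weight.** [folklore] -/
theorem mval2C_nonneg_of_lev2C {E C : Finset (Sym2 V)} {x y s : V} {F : ℕ → Pat3 → Pat3 → ℤ}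
    (h : ∀ μ : ℕ, 0 ≤ lev2C E C x y s F μ) {w : ℕ → ℝ} (hw : ∀ n, 0 ≤ w n) : 0 ≤ mval2C w E C x y s F := by
  rw [mval2C_eq_sum_lev2C w E C x y s F (E.powerset.sup (fun γ => apExpC E C γ) + 2)
    (fun γ hγ => by have := Finset.le_sup (f := fun γ => apExpC E C γ) hγ; simpa using this)]
  exact Finset.sum_nonneg fun μ _ => mul_nonneg (hw μ) (by exact_mod_cast h μ)

/-- The doubled one-level `T_sym` as a two-level table evaluates to twice `T_sym` on a minor. [folklore] -/
theorem mval2C_tsym2Tab (w : ℕ → ℝ) (E C : Finset (Sym2 V)) (x y s : V) :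
    mval2C w E C x y s tsym2Tab = 2 * tvalC w E C x y s tsymTab := by
  have h0 : ∀ P Q, tsym2Tab 0 P Q = 2 * tsymTab P Q := fun _ _ => rfl
  have h1 : ∀ P Q, tsym2Tab 1 P Q = 0 := fun _ _ => rfl
  unfold mval2C tvalC
  rw [Finset.mul_sum]
  refine Finset.sum_congr rfl fun γ _ => ?_
  rw [h0, h1]
  push_cast
  ring

/-- `tvalC` is monotone in the table for nonnegative weights. [folklore] -/
theorem tvalC_mono {w : ℕ → ℝ} {E C : Finset (Sym2 V)} {x y s : V} {t t' : Pat3 → Pat3 → ℤ} (h : ∀ P Q, t P Q ≤ t' P Q)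
    (hw : ∀ n, 0 ≤ w n) : tvalC w E C x y s t ≤ tvalC w E C x y s t' := by
  unfold tvalC
  refine Finset.sum_le_sum fun γ _ => mul_le_mul_of_nonneg_left ?_ (hw _)
  exact_mod_cast h _ _

end WeightsC

/-! ### Conjecture T's functional on a minor is the apex-table evaluation; SP-good minors -/

section AntipodalC

/-- **Conjecture T's weight-free antipodal sum of a MINOR is the `q`-weighted evaluation of the apex table on the minor**:
`antipodalT q z s t F C = tvalC (q^·) F C z s t T(apex)` (the contracted set `C` open on both sides).
[cite: AyyerLinussonRavichandran2025, §7 (p. 22)] -/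
theorem antipodalT_eq_tvalC (q : ℝ) (z s t : V) (F C : Finset (Sym2 V)) :
    antipodalT q z s t (↑F : BondConfig V) (↑C : BondConfig V) = tvalC (fun n => q ^ n) F C z s t tApexTab := by
  unfold antipodalT tvalC
  set G : BondConfig V → ℝ := fun X => if X ⊆ (↑F : BondConfig V) then
      q ^ (clusterCount ((↑C : BondConfig V) ∪ X) ∅ + clusterCount ((↑C : BondConfig V) ∪ ((↑F : BondConfig V) \ X)) ∅) *
        antipodalQ z s t ((↑C : BondConfig V) ∪ X) ((↑C : BondConfig V) ∪ ((↑F : BondConfig V) \ X)) else 0 with hG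
  have h1 : (∑ X : BondConfig V, G X) = ∑ S : Finset (Sym2 V), G (↑S : BondConfig V) := by
    rw [← Equiv.sum_comp Fintype.finsetEquivSet G]
    rfl
  have h2 : (∑ S : Finset (Sym2 V), G (↑S : BondConfig V)) =
      ∑ S : Finset (Sym2 V), if S ∈ F.powerset then G (↑S : BondConfig V) else 0 := by
    refine Finset.sum_congr rfl fun S _ => ?_
    by_cases hS : S ∈ F.powerset
    · rw [if_pos hS]
    · rw [if_neg hS, hG]
      simp only
      rw [if_neg]
      rwa [Finset.coe_subset, ← Finset.mem_powerset]
  have h3 : (∑ S : Finset (Sym2 V), if S ∈ F.powerset then G (↑S : BondConfig V) else 0) =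
      ∑ S ∈ F.powerset, G (↑S : BondConfig V) := by
    rw [← Finset.sum_filter]
    congr 1
    ext S
    simp
  rw [h1, h2, h3]
  refine Finset.sum_congr rfl fun S hS => ?_
  have hSF : S ⊆ F := Finset.mem_powerset.1 hS
  have hsub : (↑S : BondConfig V) ⊆ ↑F := Finset.coe_subset.2 hSF
  have c1 : (↑C : BondConfig V) ∪ ↑S = ↑(S ∪ C) := by rw [Finset.coe_union, Set.union_comm]
  have c2 : (↑C : BondConfig V) ∪ (↑F \ ↑S) = ↑(F \ S ∪ C) := by rw [Finset.coe_union, Finset.coe_sdiff, Set.union_comm]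
  rw [hG]
  simp only
  rw [if_pos hsub, c1, c2, antipodalQ_eq_tApexTab]
  rfl

/-- **An SP-good minor has `T_q ≥ 0`**: `SPGoodC F C b s t → 0 ≤ antipodalT q b s t F C` for every `q > 0`
(`T(apex) ≥ T_sym` entrywise, `FK.tsymTab_le_tApexTab`). [cite: AyyerLinussonRavichandran2025, §7 eq. (13)–(15) (p. 22)] -/
theorem antipodalT_nonneg_of_spGoodC {q : ℝ} (hq : 0 < q) {F C : Finset (Sym2 V)} {b s t : V} (h : SPGoodC F C b s t) :
    0 ≤ antipodalT q b s t (↑F : BondConfig V) (↑C : BondConfig V) := by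
  have hw : ∀ n, 0 ≤ (fun n => q ^ n) n := fun n => pow_nonneg hq.le n
  have h2 := mval2C_nonneg_of_lev2C (fun μ => (h μ).1) hw
  rw [mval2C_tsym2Tab] at h2
  rw [antipodalT_eq_tvalC]
  exact (show (0 : ℝ) ≤ tvalC (fun n => q ^ n) F C b s t tsymTab by linarith).trans (tvalC_mono tsymTab_le_tApexTab hw)

omit [Fintype V] in
/-- The polar form vanishes when two of the three marks coincide. [folklore] -/
theorem antipodalQ_eq_zero_of_not_distinct {z s t : V} (h : z = s ∨ z = t ∨ s = t) (ω ω' : BondConfig V) :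
    antipodalQ z s t ω ω' = 0 := by
  have huniv : ∀ c : V, (openConn c c : Set (BondConfig V)) = Set.univ := fun c =>
    Set.eq_univ_of_forall fun ξ => (mem_openConn_iff' c c ξ).2 SimpleGraph.Reachable.rfl
  rw [antipodalQ_eq_mul]
  rcases h with h | h | h
  · subst h
    rw [huniv, Set.univ_union, ind_of_mem (Set.mem_univ ω), ind_of_mem (Set.mem_univ ω'), sub_self, mul_zero]
  · subst h
    rw [huniv, Set.union_univ, ind_of_mem (Set.mem_univ ω), ind_of_mem (Set.mem_univ ω'), sub_self, mul_zero]
  · subst h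
    rw [huniv, ind_of_mem (Set.mem_univ ω), ind_of_mem (Set.mem_univ ω'), sub_self, zero_mul]

/-- `T_q(z,s,t;F,ρ) = 0` when two of the three marks coincide. [folklore] -/
theorem antipodalT_eq_zero_of_not_distinct (q : ℝ) {z s t : V} (h : z = s ∨ z = t ∨ s = t) (F ρ : BondConfig V) :
    antipodalT q z s t F ρ = 0 := by
  unfold antipodalT
  refine Finset.sum_eq_zero fun X _ => ?_
  split_ifs
  · rw [antipodalQ_eq_zero_of_not_distinct h, mul_zero]
  · rfl

end AntipodalC

/-! ### Local form: SP-good minors of the support give `δ ≥ 0` and the hub inequality for every weight vector on it -/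

section LocalSP

variable (w : Sym2 V → unitInterval)

/-- **SP-goodness of the minors of the support gives `δ_w ≥ 0`**: if every minor `(E, C)`, `E, C ⊆ N`, is SP-good at every three
distinct marks on `N`, then `δ_w(b; s, t) ≥ 0` for every `q > 0`, every `w` supported in `N` and all distinct `b, s, t` on `N`
(`FK.deltaMass_nonneg_of_support` + `FK.antipodalT_nonneg_of_spGoodC`).  THEOREM SP supplies the hypothesis for two-terminal
series–parallel `N` (`…Pat3DeltaSP.lean`); CONJECTURE SP says it always holds. [cite: AyyerLinussonRavichandran2025, §7 eq. (13)–(15) (p. 22)] -/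
theorem deltaMass_nonneg_of_spGood_support {q : ℝ} (hq : 0 < q) {N : Finset (Sym2 V)}
    (hN : ∀ E C : Finset (Sym2 V), E ⊆ N → C ⊆ N → ∀ b s t : V, (∃ e ∈ N, b ∈ e) → (∃ e ∈ N, s ∈ e) → (∃ e ∈ N, t ∈ e) →
      b ≠ s → b ≠ t → s ≠ t → SPGoodC E C b s t)
    (hw : ∀ e, ((w e : unitInterval) : ℝ) ≠ 0 → e ∈ (↑N : Set (Sym2 V))) {b s t : V}
    (hb : ∃ e ∈ N, b ∈ e) (hs : ∃ e ∈ N, s ∈ e) (ht : ∃ e ∈ N, t ∈ e) (hbs : b ≠ s) (hbt : b ≠ t) (hst : s ≠ t) :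
    0 ≤ deltaMass w q b s t :=
  deltaMass_nonneg_of_support w hw fun E C hE hC _ => antipodalT_nonneg_of_spGoodC hq (hN E C hE hC b s t hb hs ht hbs hbt hst)

/-- **SP-goodness of the minors of the support gives the hub inequality ALR (13)/(14) at EVERY triple of vertices** for every
`φ_{w,q}`, `q > 0`, supported in `N`. [cite: AyyerLinussonRavichandran2025, §7 eq. (13)–(14), Conj. 7.1 (p. 22)] -/
theorem hubUnder_of_spGood_support {q : ℝ} (hq : 0 < q) {N : Finset (Sym2 V)}
    (hN : ∀ E C : Finset (Sym2 V), E ⊆ N → C ⊆ N → ∀ b s t : V, (∃ e ∈ N, b ∈ e) → (∃ e ∈ N, s ∈ e) → (∃ e ∈ N, t ∈ e) →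
      b ≠ s → b ≠ t → s ≠ t → SPGoodC E C b s t)
    (hw : ∀ e, ((w e : unitInterval) : ℝ) ≠ 0 → e ∈ (↑N : Set (Sym2 V))) (o a b : V) : HubUnder (rcMeasureW w q ∅) o a b :=
  hubUnder_of_deltaMass_nonneg_on w hq hw
    (fun _ _ _ hb hs ht hbs hbt hst => deltaMass_nonneg_of_spGood_support w hq hN hw hb hs ht hbs hbt hst) o a b

/-- **… and the sharper correlation of `{s ↔ t}` with `{b ↔ s} ∪ {b ↔ t}` at every triple.** [cite: AyyerLinussonRavichandran2025, §7 (p. 22)] -/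
theorem real_conn_union_le_of_spGood_support {q : ℝ} (hq : 0 < q) {N : Finset (Sym2 V)}
    (hN : ∀ E C : Finset (Sym2 V), E ⊆ N → C ⊆ N → ∀ b s t : V, (∃ e ∈ N, b ∈ e) → (∃ e ∈ N, s ∈ e) → (∃ e ∈ N, t ∈ e) →
      b ≠ s → b ≠ t → s ≠ t → SPGoodC E C b s t)
    (hw : ∀ e, ((w e : unitInterval) : ℝ) ≠ 0 → e ∈ (↑N : Set (Sym2 V))) (b s t : V) :
    (rcMeasureW w q ∅).real (openConn s t) * (rcMeasureW w q ∅).real (openConn b s ∪ openConn b t) ≤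
      (rcMeasureW w q ∅).real Set.univ * (rcMeasureW w q ∅).real (openConn s t ∩ (openConn b s ∪ openConn b t)) :=
  real_conn_union_le_of_deltaMass_nonneg_on w hq hw
    (fun _ _ _ hb hs ht hbs hbt hst => deltaMass_nonneg_of_spGood_support w hq hN hw hb hs ht hbs hbt hst) b s t

end LocalSP

/-! ### CONJECTURE SP and its reduction of Conjecture T / the hub conjecture -/

section ConjectureSP

/-- **CONJECTURE SP (census g37) — every minor of every finite graph is SP-good at every three distinct marks.**  CONJECTURE-SHAPED
STATEMENT, NOT asserted.  Content: for the minor "keep `E` free, contract `C`" of the complete graph on `Fin n` and pairwise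
distinct `b, s, t`, at every level `ν` (total cluster count of an antipodal pair `(X ∪ C, (E∖X) ∪ C)`), the symmetric three-point
count `T_sym(b,s,t)` and the three `STAR` counts are nonnegative (`FK.SPGoodC`).  THEOREM on two-terminal series–parallel networks
(`FK.spGoodC_of_isTTSP`); EVIDENCE beyond (census g37: kit j226017, j226060, j226107, j226360; census g38: j227693, j227806,
j227858, j227889, pair-partition transfer engine): 0 exceptions on every minor `(E, C)` of every graph with ≤ 6 vertices, of every
graph with 7 vertices and ≤ 16 edges (denser ones: 4,096 random `C` each), on every graph with ≤ 9 vertices at `C = ∅` (all 261,080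
connected 9-vertex graphs), on 5.7 × 10⁶ sampled minors of the 8-vertex graphs, and on 35,000 random plus 76 named graphs with
10–12 vertices (`K_{a,b}`, `a+b ≤ 12`, wheels, prisms, Möbius ladders, Petersen, `K₉`, `K₁₀`) — ≈ 1.5 × 10¹⁰ (member, placement)
checks.  Implies Conjecture T (`FK.antipodalTPos_of_spGoodPos`) and the hub conjecture (`FK.hubFKPos_of_spGoodPos`).
[cite: AyyerLinussonRavichandran2025, §7 eq. (13)–(15), Conj. 7.1 (p. 22)] [cite: Grimmett2006, §3.9 (p. 63)] -/
@[conjecture] def SPGoodPos : Prop :=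
  ∀ (n : ℕ) (E C : Finset (Sym2 (Fin n))) (b s t : Fin n), b ≠ s → b ≠ t → s ≠ t → SPGoodC E C b s t

/-- **CONJECTURE SP ⇒ antipodal nonnegativity at `q` on every `Fin n`** (`FK.AntipodalTFK q`), every `q > 0`.
[cite: AyyerLinussonRavichandran2025, §7 eq. (13)–(15) (p. 22)] -/
theorem antipodalTFK_of_spGoodPos (h : SPGoodPos) {q : ℝ} (hq : 0 < q) : AntipodalTFK q := by
  intro n z s t F ρ _
  by_cases hd : z = s ∨ z = t ∨ s = t
  · rw [antipodalT_eq_zero_of_not_distinct q hd]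
  have hzs : z ≠ s := fun e => hd (Or.inl e)
  have hzt : z ≠ t := fun e => hd (Or.inr (Or.inl e))
  have hst : s ≠ t := fun e => hd (Or.inr (Or.inr e))
  set F' : Finset (Sym2 (Fin n)) := Finset.univ.filter (fun e => e ∈ F) with hF'
  set ρ' : Finset (Sym2 (Fin n)) := Finset.univ.filter (fun e => e ∈ ρ) with hρ'
  have cF : (↑F' : BondConfig (Fin n)) = F := by ext e; simp [hF']
  have cρ : (↑ρ' : BondConfig (Fin n)) = ρ := by ext e; simp [hρ']
  rw [← cF, ← cρ]
  exact antipodalT_nonneg_of_spGoodC hq (h n F' ρ' z s t hzs hzt hst)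

/-- **CONJECTURE SP ⇒ CONJECTURE T** (`FK.AntipodalTPos`, census gen 25). [cite: AyyerLinussonRavichandran2025, §7 eq. (13)–(15) (p. 22)] -/
theorem antipodalTPos_of_spGoodPos (h : SPGoodPos) : AntipodalTPos := fun _ hq => antipodalTFK_of_spGoodPos h hq

/-- **CONJECTURE SP ⇒ THE HUB CONJECTURE** (`FK.HubFKPos`: ALR (13)/(14) for every `φ_{w,q}`, `q > 0`).
[cite: AyyerLinussonRavichandran2025, §7 eq. (13)–(15), Conj. 7.1 (p. 22)] -/
theorem hubFKPos_of_spGoodPos (h : SPGoodPos) : HubFKPos := hubFKPos_of_antipodalTPos (antipodalTPos_of_spGoodPos h)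

end ConjectureSP

end FK

end Summit.CriticalPhenomena.PercolationContinuityZ3.Theorems
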